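import Summits.MatrixMultiplication.OmegaCensus.STPPVosperCoverSearchW

/-!
# ω-census (abelian STPP census): SOUNDNESS of stage 1 of the cover search with words (kernel, UNCONDITIONAL)

HONEST FRAMING (pub-omega census; verbatim): lottery ticket; floor = certified bounds/negative ranges.
Census STRUCTURE (seat pub-omega-stpp-2 gen 25, 2026-08-28), family (b2).  `coverYW_complete`: as `coverY_complete` (`STPPVosperCoverSearchSound.lean`) for the
search with words `coverYW` of `STPPVosperCoverSearchW.lean` — genuine blocks satisfying, besides the cover hypotheses, the word facts (`a ≠ a′` / cross-block
`A`-letters: `((c−a) + (a′−b)) mod p ∉ YL`; `b ≠ b′`: `((c−a) + (b−b′)) mod p ∉ ZL`) make the search return `true`.  Nothing here is progress on `ω`.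

References: H. Cohn, R. Kleinberg, B. Szegedy, C. Umans, FOCS 2005 (arXiv:math/0511460), Def. 5.1.
-/

open Finset
open scoped Pointwise

namespace Summit.MatrixMultiplication.OmegaCensus.CubeNB

open Literature.Computability.AlgebraicComplexity
open Literature.Combinatorics.Additive
open Summit.MatrixMultiplication.OmegaCensus.STPPKneser

/-! ## §1 Soundness of stage 1 with words -/

section Sound

variable {ι : Type*} {p : ℕ} (good : ι → Prop) (sz : ι → ℕ × ℕ × ℕ) (Av Bv Cv : ι → Finset ℕ) (YL ZL : List ℕ)

/-- **Soundness of stage 1 (and hence of the whole search).**  Blocks `ks` still to place (distinct, good) inside remaining Y-points `RY` (their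
Y-differences lie in `RY`, are pairwise distinct and cover `RY`), already placed blocks `done`, and Z-hypotheses for the union of both index sets over
`RZ`: then `coverY` succeeds. [folklore] -/
theorem coverYW_complete (hszA : ∀ k, good k → #(Av k) = (sz k).1) (hszB : ∀ k, good k → #(Bv k) = (sz k).2.1)
    (hszC : ∀ k, good k → #(Cv k) = (sz k).2.2)
    (hAp : ∀ k, ∀ x ∈ Av k, x < p) (hBp : ∀ k, ∀ x ∈ Bv k, x < p) (hCp : ∀ k, ∀ x ∈ Cv k, x < p) (hB0 : ∀ k, good k → 0 ∈ Bv k)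
    (hCne : ∀ k, good k → (Cv k).Nonempty)
    (hinjY : ∀ k, good k → ∀ c ∈ Cv k, ∀ c' ∈ Cv k, ∀ x ∈ Bv k, ∀ x' ∈ Bv k, (c + p - x) % p = (c' + p - x') % p → c = c' ∧ x = x')
    (hinjZ : ∀ k, good k → ∀ c ∈ Cv k, ∀ c' ∈ Cv k, ∀ x ∈ Av k, ∀ x' ∈ Av k, (c + p - x) % p = (c' + p - x') % p → c = c' ∧ x = x')
    (hinjX : ∀ k, good k → ∀ c ∈ Av k, ∀ c' ∈ Av k, ∀ x ∈ Bv k, ∀ x' ∈ Bv k, (c + p - x) % p = (c' + p - x') % p → c = c' ∧ x = x')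
    (hmin : ∀ k, good k → ∃ c₀ ∈ Cv k, ∀ c ∈ Cv k, ∀ x ∈ Bv k, c₀ ≤ (c + p - x) % p)
    (hWY : ∀ k, good k → ∀ k', good k' → ∀ c ∈ Cv k, ∀ a ∈ Av k, ∀ a' ∈ Av k', ∀ b ∈ Bv k', (k ≠ k' ∨ a ≠ a') →
      ((c + p - a) % p + (a' + p - b) % p) % p ∉ YL)
    (hWZ : ∀ k, good k → ∀ c ∈ Cv k, ∀ a ∈ Av k, ∀ b ∈ Bv k, ∀ b' ∈ Bv k, b ≠ b' → ((c + p - a) % p + (b + p - b') % p) % p ∉ ZL) (RZ : List ℕ) :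
    ∀ (ks : List ι), ks.Nodup → (∀ k ∈ ks, good k) → ∀ (done : List (ι × List ℕ × List ℕ)) (RY : List ℕ), RY.Nodup →
      (done.map Prod.fst).Nodup → (∀ e ∈ done, e.1 ∉ ks) → (∀ e ∈ done, (good e.1 ∧ e.2.1.Nodup ∧ (∀ x, x ∈ e.2.1 ↔ x ∈ Cv e.1) ∧ (0 :: e.2.2).Nodup ∧ (∀ x, x ∈ (0 :: e.2.2) ↔ x ∈ Bv e.1))) →
      (∀ k ∈ ks, ∀ c ∈ Cv k, ∀ x ∈ Bv k, (c + p - x) % p ∈ RY) →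
      (∀ k ∈ ks, ∀ k' ∈ ks, k ≠ k' → ∀ c ∈ Cv k, ∀ x ∈ Bv k, ∀ c' ∈ Cv k', ∀ x' ∈ Bv k', (c + p - x) % p ≠ (c' + p - x') % p) →
      (∀ y ∈ RY, ∃ k ∈ ks, ∃ c ∈ Cv k, ∃ x ∈ Bv k, (c + p - x) % p = y) →
      (∀ k, (k ∈ ks ∨ k ∈ done.map Prod.fst) → ∀ c ∈ Cv k, ∀ x ∈ Av k, (c + p - x) % p ∈ RZ) →
      (∀ k k', (k ∈ ks ∨ k ∈ done.map Prod.fst) → (k' ∈ ks ∨ k' ∈ done.map Prod.fst) → k ≠ k' →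
        ∀ c ∈ Cv k, ∀ x ∈ Av k, ∀ c' ∈ Cv k', ∀ x' ∈ Av k', (c + p - x) % p ≠ (c' + p - x') % p) →
      (∀ t ∈ RZ, ∃ k, (k ∈ ks ∨ k ∈ done.map Prod.fst) ∧ ∃ c ∈ Cv k, ∃ x ∈ Av k, (c + p - x) % p = t) →
      coverYW p YL ZL RZ RY (ks.map sz) (done.map fun e => ((sz e.1).1, e.2.1, e.2.2)) = true := by
  intro ks
  induction ks with
  | nil =>
    intro _ _ done RY _ hdnd _ hok _ _ hcovY hZ hdisjZ hcovZ
    have hRY : RY = [] := by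
      cases RY with
      | nil => rfl
      | cons y _ => obtain ⟨k, hk, -⟩ := hcovY y (by simp); simp at hk
    subst hRY
    rw [List.map_nil, coverYW, List.isEmpty_nil, Bool.true_and]
    apply coverZW_complete good sz Av Bv Cv YL ZL hszA hAp hCp hCne hinjZ hinjX hWY hWZ done hdnd hok RZ [] (by simp)
    · intro e he c hc x hx
      exact hZ e.1 (Or.inr (List.mem_map.2 ⟨e, he, rfl⟩)) c hc x hx
    · intro e he e' he' hne
      exact hdisjZ e.1 e'.1 (Or.inr (List.mem_map.2 ⟨e, he, rfl⟩)) (Or.inr (List.mem_map.2 ⟨e', he', rfl⟩)) hne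
    · intro t ht
      obtain ⟨k, hk, c, hc, x, hx, h⟩ := hcovZ t ht
      rcases hk with hk | hk
      · simp at hk
      · obtain ⟨e, he, rfl⟩ := List.mem_map.1 hk
        exact ⟨e, he, c, hc, x, hx, h⟩
  | cons k rest ih =>
    intro hnd hgood done RY hRY hdnd hdisjdone hok hY hdisjY hcovY hZ hdisjZ hcovZ
    rw [List.nodup_cons] at hnd
    obtain ⟨hkrest, hndrest⟩ := hnd
    have hgk : good k := hgood k (by simp)
    have hgrest : ∀ k' ∈ rest, good k' := fun k' hk' => hgood k' (by simp [hk'])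
    rcases hsz : sz k with ⟨a, b, c⟩
    have hca : #(Av k) = a := by simp [hszA k hgk, hsz]
    have hcb : #(Bv k) = b := by simp [hszB k hgk, hsz]
    have hcc : #(Cv k) = c := by simp [hszC k hgk, hsz]
    -- stage-1 lists of block k
    obtain ⟨Cl, Bl, hClnd, hClmem, hB0nd, hB0l, hmemY⟩ := exists_yCands_of_block hRY (Bv k) (Cv k) (hBp k) (hCp k) (hB0 k hgk)
      (hCne k hgk) (hY k (by simp)) (hinjY k hgk) (hmin k hgk)
    rw [hcb, hcc] at hmemY
    -- stage-2 list of block k (for the candidate-count test)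
    obtain ⟨Al, -, -, hAlsub, -, -⟩ := exists_aList_of_block (RZ := RZ) (Av k) (Bv k) (Cv k) hClnd hClmem hB0nd hB0l
      (hAp k) (hCp k) (hCne k hgk) (hZ k (Or.inl (by simp))) (hinjZ k hgk) (hinjX k hgk)
    have hlen : a ≤ (shiftCands p Cl RZ).length := by
      obtain ⟨hsub, hl⟩ := List.mem_sublistsLen.1 hAlsub
      rw [← hca, ← hl]
      exact hsub.length_le
    rw [List.map_cons, hsz, coverYW, List.any_eq_true]
    refine ⟨(Cl, Bl), hmemY, ?_⟩
    rw [Bool.and_eq_true, decide_eq_true_eq]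
    refine ⟨hlen, ?_⟩
    -- meaning of the Y-difference list of this block
    have hYmem : ∀ y, y ∈ diffList p Cl (0 :: Bl) ↔ ∃ c' ∈ Cv k, ∃ x ∈ Bv k, (c' + p - x) % p = y := by
      intro y; rw [mem_diffList]
      constructor
      · rintro ⟨c', hc', x, hx, h⟩; exact ⟨c', (hClmem _).1 hc', x, (hB0l _).1 hx, h⟩
      · rintro ⟨c', hc', x, hx, h⟩; exact ⟨c', (hClmem _).2 hc', x, (hB0l _).2 hx, h⟩
    -- the recursive call with block k moved to `done`
    have hcall := ih hndrest hgrest ((k, Cl, Bl) :: done) (RY.filter fun y => !(decide (y ∈ diffList p Cl (0 :: Bl))))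
      (hRY.filter _) ?_ ?_ ?_ ?_ ?_ ?_ ?_ ?_ ?_
    · simpa [hsz] using hcall
    · -- indices of done' are distinct
      rw [List.map_cons, List.nodup_cons]
      refine ⟨fun hmem => ?_, hdnd⟩
      obtain ⟨e, he, hek⟩ := List.mem_map.1 hmem
      exact hdisjdone e he (by simp [hek])
    · -- done' indices are not in rest
      intro e he
      rw [List.mem_cons] at he
      rcases he with rfl | he
      · exact hkrest
      · exact fun h => hdisjdone e he (by simp [h])
    · -- entries OK
      intro e he
      rw [List.mem_cons] at he
      rcases he with rfl | he
      · exact ⟨hgk, hClnd, hClmem, hB0nd, hB0l⟩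
      · exact hok e he
    · -- Y-differences of the rest lie in the filtered list
      intro k' hk' c' hc' x hx
      rw [List.mem_filter]
      refine ⟨hY k' (by simp [hk']) c' hc' x hx, ?_⟩
      rw [Bool.not_eq_true', decide_eq_false_iff_not]
      intro hmem
      obtain ⟨c₂, hc₂, x₂, hx₂, h₂⟩ := (hYmem _).1 hmem
      exact hdisjY k (by simp) k' (by simp [hk']) (fun heq => hkrest (heq ▸ hk')) c₂ hc₂ x₂ hx₂ c' hc' x hx h₂
    · intro k₁ hk₁ k₂ hk₂ hne
      exact hdisjY k₁ (by simp [hk₁]) k₂ (by simp [hk₂]) hne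
    · -- coverage of the filtered list by the rest
      intro y hy
      rw [List.mem_filter, Bool.not_eq_true', decide_eq_false_iff_not] at hy
      obtain ⟨hyRY, hynot⟩ := hy
      obtain ⟨k', hk', c', hc', x, hx, h⟩ := hcovY y hyRY
      rw [List.mem_cons] at hk'
      rcases hk' with rfl | hk'
      · exact absurd ((hYmem y).2 ⟨c', hc', x, hx, h⟩) hynot
      · exact ⟨k', hk', c', hc', x, hx, h⟩
    · -- Z-hypotheses: same index set
      intro k' hk'
      refine hZ k' ?_
      rw [List.map_cons, List.mem_cons] at hk'
      rcases hk' with hk' | rfl | hk'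
      · exact Or.inl (by simp [hk'])
      · exact Or.inl (by simp)
      · exact Or.inr hk'
    · intro k₁ k₂ hk₁ hk₂ hne
      refine hdisjZ k₁ k₂ ?_ ?_ hne
      · rw [List.map_cons, List.mem_cons] at hk₁
        rcases hk₁ with hk₁ | rfl | hk₁
        · exact Or.inl (by simp [hk₁])
        · exact Or.inl (by simp)
        · exact Or.inr hk₁
      · rw [List.map_cons, List.mem_cons] at hk₂
        rcases hk₂ with hk₂ | rfl | hk₂
        · exact Or.inl (by simp [hk₂])
        · exact Or.inl (by simp)
        · exact Or.inr hk₂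
    · intro t ht
      obtain ⟨k', hk', c', hc', x, hx, h⟩ := hcovZ t ht
      refine ⟨k', ?_, c', hc', x, hx, h⟩
      rw [List.map_cons, List.mem_cons]
      rcases hk' with hk' | hk'
      · rw [List.mem_cons] at hk'
        rcases hk' with rfl | hk'
        · exact Or.inr (Or.inl rfl)
        · exact Or.inl hk'
      · exact Or.inr (Or.inr hk')

end Sound

end Summit.MatrixMultiplication.OmegaCensus.CubeNB
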